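import Literature.Analysis.FluidPDE.CompressibleEulerImplosionMonatomicAlgebra
import HarnessLib

/-!
# Buckmaster–Cao-Labora–Gómez-Serrano at `γ = 5/3`: the auxiliary sign lemmas of Appendix A

Topic `Literature/Analysis/FluidPDE`; namespace
`Literature.Analysis.FluidPDE.BuckmasterCaolaboraGomezserrano2025.Monatomic`. Companion of
`CompressibleEulerImplosion.lean` (named fact `BuckmasterCaolaboraGomezserrano2025_thm11_monatomic`,
THEOREM 1.1 of T. Buckmaster, G. Cao-Labora, J. Gómez-Serrano, *Smooth imploding solutions for 3D
compressible fluids*, Forum Math. Pi 13 (2025) e6, arXiv:2208.09445, at `γ = 5/3`, `α = 1/3`)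
and of `CompressibleEulerImplosionMonatomicAlgebra.lean` (Brick B: `NW`, `NZ`, `DW`, `DZ`, the
sonic point `P_s = (W0 r, Z0 r)`, `P̄_s = (W0bar r, Z0bar r)`, `q r = ℛ₁·3/4`, `p r`, `W1`, `Z1`,
`P_eye = (Xeye r, Yeye r)`).

Brick AUX of the discharge plan — the hand-proved (NOT computer-assisted) sign lemmas of
Appendix A that drive the barrier arguments of Proposition 2.5 (the `P₀`-trajectory stays in the
triangle `𝒯^{(H)}` and reaches `P_s`) and of Proposition 3.1, specialised to `γ = 5/3` where the
closed forms of Brick B turn each of them into an explicit polynomial inequality: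

* Lemma 9.16 (`aux_NWtriangle`): `N_W < 0` on the triangle `𝒯^{(M)} = {P_s + t(1, s)}`,
  `t ≥ 0`, `s ∈ [−1, −(1−α)/(1+α)] = [−1, −1/2]` (`NW_triangle_neg`);
* Lemma 9.20: `N_W < 0` on the vertical segment from `P_s` to `(W₀, W₀)` (`NW_vertical_neg`);
* Lemma 9.21 (`aux_diagonal_from_P2`): on the half-line `S₁ = {(W₀ + t, Z₀ − t), t > 0}` the
  desingularised field satisfies `(N_W D_Z, N_Z D_W)·(−1,−1) > 0` (`S1_crossing`);
* Lemma 9.22 (`aux_DZ=0_repels`): on the sonic line `D_Z = 0`, `N_Z = ½(Z − Z₀)(Z − Z̄₀)`, so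
  `∇D_Z·(N_W D_Z, N_Z D_W) = ⅔ D_W N_Z` is positive right of `P_s`, negative between `P̄_s` and
  `P_s`, positive left of `P̄_s` (`NZ_on_sonicLine`, `sonicLine_flux`, sign corollaries);
* the closed-form items of Lemma 9.26 (`aux_34bounds`): `W₁ < 0`, `N_{Z,1} = D_{Z,1} Z₁ > 0`,
  `∂_Z N_Z(P_s) > 0`, `D_Z(P_eye) > 0 ⇔ r < r*`, `(X₀ + Y₀)/2 = −r/2 > −r`.

Theorems only. [cite: BuckmasterCaolaboraGomezserrano2025, App. A, Lemmas 9.16, 9.20, 9.21, 9.22, 9.26]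
-/

noncomputable section

open Set

namespace Literature.Analysis.FluidPDE

namespace BuckmasterCaolaboraGomezserrano2025

namespace Monatomic

variable {r : ℝ}

/-! ### Lemma 9.16: `N_W < 0` on the triangle `𝒯^{(M)}` -/

/-- Exact second-order expansion of `N_W` at `P_s` along the direction `(1, s)`:
`N_W(P_s + t(1,s)) = N_W(P_s) + t((r−2)(2+s) − q(3+s)) + t²(s² − 2s − 5)/6`.
[cite: BuckmasterCaolaboraGomezserrano2025, Lemma 9.16 (proof)] -/
theorem NW_triangle_expand (r t s : ℝ) :
    NW r (W0 r + t) (Z0 r + t * s)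
      = NW r (W0 r) (Z0 r) + t * ((r - 2) * (2 + s) - q r * (3 + s)) + t ^ 2 * ((s ^ 2 - 2 * s - 5) / 6) := by
  unfold NW W0 Z0; ring

/-- **Lemma 9.16 at `γ = 5/3`** (`aux_NWtriangle`): for `1 < r < r*`, `N_W < 0` at every point
`P_s + t(1, s)` with `t ≥ 0`, `s ∈ [−1, −1/2]`, i.e. on every triangle `𝒯^{(M)}` with vertices `P_s`,
`P_s + (M, −M)` and the point of `D_Z = 0` above `P_s + (M, −M)`.
[cite: BuckmasterCaolaboraGomezserrano2025, Lemma 9.16] -/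
theorem NW_triangle_neg (h1 : 1 < r) (hr : r < rstar) {t s : ℝ} (ht : 0 ≤ t) (hs1 : -1 ≤ s)
    (hs2 : s ≤ -1 / 2) : NW r (W0 r + t) (Z0 r + t * s) < 0 := by
  rw [NW_triangle_expand]
  have h0 := NW_Ps_neg hr
  have hq := q_pos hr
  have hr2 : r < 2 := by linarith [rstar_lt]
  have hA : (r - 2) * (2 + s) - q r * (3 + s) < 0 := by nlinarith
  have hB : (s ^ 2 - 2 * s - 5) / 6 < 0 := by nlinarith
  nlinarith [mul_nonneg ht (le_of_lt (neg_pos.mpr hA)), mul_nonneg (sq_nonneg t) (le_of_lt (neg_pos.mpr hB))]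

/-- The triangle is bounded above by the sonic line: `D_Z(P_s + t(1,s)) = t(1 + 2s)/3`, which
vanishes exactly for `s = −1/2` (and is negative for `s < −1/2`, `t > 0`: the triangle lies in
`D_Z ≤ 0`). [cite: BuckmasterCaolaboraGomezserrano2025, Lemma 9.16] -/
theorem DZ_triangle (r t s : ℝ) : DZ (W0 r + t) (Z0 r + t * s) = t * (1 + 2 * s) / 3 := by
  unfold DZ W0 Z0; ring

/-! ### Lemma 9.20: `N_W < 0` on the vertical segment `[(W₀, Z₀), (W₀, W₀)]` -/

/-- `N_W(W₀, W₀) = −r W₀ − W₀²`. [cite: BuckmasterCaolaboraGomezserrano2025, Lemma 9.20 (proof)] -/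
theorem NW_W0_W0 (r : ℝ) : NW r (W0 r) (W0 r) = -r * W0 r - W0 r ^ 2 := by
  unfold NW; ring

/-- `W₀ > 0` for `r < 3/2`. [folklore] -/
theorem W0_pos (h : r < 3 / 2) : 0 < W0 r := by
  unfold W0; linarith [q_nonneg r]

/-- `W₀ − Z₀ = 6 − 3r + 3q > 0` for `r < 2`. [folklore] -/
theorem W0_sub_Z0_pos (h : r < 2) : 0 < W0 r - Z0 r := by
  unfold W0 Z0; linarith [q_nonneg r]

/-- **Lemma 9.20 at `γ = 5/3`**: for `1 < r < r*` (in particular on `(r₃, r₄)`), `N_W(W₀, y) < 0`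
for every `y ∈ [Z₀, W₀]` (convexity in `y` and negativity at both endpoints).
[cite: BuckmasterCaolaboraGomezserrano2025, Lemma 9.20] -/
theorem NW_vertical_neg (h1 : 1 < r) (hr : r < rstar) {y : ℝ} (hy1 : Z0 r ≤ y) (hy2 : y ≤ W0 r) :
    NW r (W0 r) y < 0 := by
  have hr2 : r < 3 / 2 := by linarith [rstar_lt]
  have hW0 := W0_pos hr2
  have hd := W0_sub_Z0_pos (show r < 2 by linarith)
  have hA : NW r (W0 r) (Z0 r) < 0 := NW_Ps_neg hr
  have hB : NW r (W0 r) (W0 r) < 0 := by rw [NW_W0_W0]; nlinarith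
  -- chord identity for the quadratic `y ↦ N_W(W₀, y)` (leading coefficient `1/6`)
  have key : (W0 r - Z0 r) * NW r (W0 r) y = (W0 r - y) * NW r (W0 r) (Z0 r)
      + (y - Z0 r) * NW r (W0 r) (W0 r) + (y - Z0 r) * (y - W0 r) * (W0 r - Z0 r) / 6 := by
    unfold NW; ring
  have hprod : (y - Z0 r) * (y - W0 r) * (W0 r - Z0 r) / 6 ≤ 0 := by
    have : (y - Z0 r) * (y - W0 r) ≤ 0 := by nlinarith
    have := mul_nonpos_of_nonpos_of_nonneg this hd.le
    linarith
  by_contra hcon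
  have hge : 0 ≤ NW r (W0 r) y := not_lt.mp hcon
  have h3 : 0 ≤ (W0 r - Z0 r) * NW r (W0 r) y := mul_nonneg hd.le hge
  rcases eq_or_lt_of_le hy1 with heq | hlt
  · rw [← heq] at key h3
    nlinarith
  · nlinarith [mul_pos (sub_pos.mpr hlt) (neg_pos.mpr hB),
      mul_nonneg (sub_nonneg.mpr hy2) (le_of_lt (neg_pos.mpr hA))]

/-! ### Lemma 9.21: the field crosses the half-line `S₁` of slope `−1` from `P_s` -/

/-- On `S₁ = {(W₀ + t, Z₀ − t)}`: `N_W D_Z + N_Z D_W = (t/2)((2/3)(r − 2 + q) t − 4(r − 1))`.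
[cite: BuckmasterCaolaboraGomezserrano2025, Lemma 9.21 (proof)] -/
theorem S1_expand (hdisc : 0 ≤ disc r) (t : ℝ) :
    NW r (W0 r + t) (Z0 r - t) * DZ (W0 r + t) (Z0 r - t)
      + NZ r (W0 r + t) (Z0 r - t) * DW (W0 r + t) (Z0 r - t)
      = t / 2 * (2 / 3 * (r - 2 + q r) * t - 4 * (r - 1)) := by
  have hq := q_sq hdisc
  unfold NW NZ DW DZ W0 Z0
  linear_combination (q r / 2 - r / 2 + t + 1) * hq

/-- `r − 2 + q < 0` for `1 < r < r*` (i.e. `q < 2 − r`). [folklore] -/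
theorem q_lt_two_sub (h1 : 1 < r) (hr : r < rstar) : r - 2 + q r < 0 := by
  have hq := q_sq (disc_pos hr).le
  have hq0 := q_nonneg r
  have hr2 : r < 2 := by linarith [rstar_lt]
  nlinarith

/-- **Lemma 9.21 at `γ = 5/3`** (`aux_diagonal_from_P2`): for `1 < r < r*`, on the half-line
`S₁ = {(W₀ + t, Z₀ − t) : t > 0}` the desingularised field `(N_W D_Z, N_Z D_W)` satisfies
`(N_W D_Z, N_Z D_W)·(−1, −1) > 0`, i.e. `N_W D_Z + N_Z D_W < 0`.
[cite: BuckmasterCaolaboraGomezserrano2025, Lemma 9.21] -/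
theorem S1_crossing (h1 : 1 < r) (hr : r < rstar) {t : ℝ} (ht : 0 < t) :
    NW r (W0 r + t) (Z0 r - t) * DZ (W0 r + t) (Z0 r - t)
      + NZ r (W0 r + t) (Z0 r - t) * DW (W0 r + t) (Z0 r - t) < 0 := by
  rw [S1_expand (disc_pos hr).le]
  have hA := q_lt_two_sub h1 hr
  have : 2 / 3 * (r - 2 + q r) * t - 4 * (r - 1) < 0 := by nlinarith
  nlinarith

/-! ### Lemma 9.22: the sonic line `D_Z = 0` repels (`aux_DZ=0_repels`) -/

/-- Points of the sonic line `D_Z = 0` are `(−3 − 2Z, Z)`. [folklore] -/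
theorem DZ_sonicLine (Z : ℝ) : DZ (-3 - 2 * Z) Z = 0 := by unfold DZ; ring

/-- On the sonic line, `D_W = (W − Z)/3 = −1 − Z` (positive exactly in the half `W > Z`, i.e.
`Z < −1`). [cite: BuckmasterCaolaboraGomezserrano2025, Lemma 9.22 (proof)] -/
theorem DW_sonicLine (Z : ℝ) : DW (-3 - 2 * Z) Z = -1 - Z := by unfold DW; ring

/-- **Lemma 9.22 at `γ = 5/3`, the factorisation**: on `D_Z = 0`,
`N_Z(−3 − 2Z, Z) = ½(Z − Z₀)(Z − Z̄₀)` — the two solutions of `N_Z = D_Z = 0` are `P_s` and `P̄_s`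
(Bézout). [cite: BuckmasterCaolaboraGomezserrano2025, Lemma 9.22] -/
theorem NZ_on_sonicLine (hdisc : 0 ≤ disc r) (Z : ℝ) :
    NZ r (-3 - 2 * Z) Z = 1 / 2 * (Z - Z0 r) * (Z - Z0bar r) := by
  have hq := q_sq hdisc
  unfold NZ Z0 Z0bar
  linear_combination (1 / 2 : ℝ) * hq

/-- The flux of the desingularised field `(N_W D_Z, N_Z D_W)` through the sonic line:
`∇D_Z·(N_W D_Z, N_Z D_W) = ⅔ D_W N_Z` there (`∇D_Z = (1/3, 2/3)`; `(γ+1)/4 = 2/3`).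
[cite: BuckmasterCaolaboraGomezserrano2025, Lemma 9.22 (proof)] -/
theorem sonicLine_flux (r Z : ℝ) :
    1 / 3 * (NW r (-3 - 2 * Z) Z * DZ (-3 - 2 * Z) Z)
      + 2 / 3 * (NZ r (-3 - 2 * Z) Z * DW (-3 - 2 * Z) Z)
      = 2 / 3 * DW (-3 - 2 * Z) Z * NZ r (-3 - 2 * Z) Z := by
  rw [DZ_sonicLine]; ring

/-- `Z₀ < Z̄₀` for `r < r*` (`P_s` is the rightmost of the two: `W = −3 − 2Z` decreases in `Z`).
[cite: BuckmasterCaolaboraGomezserrano2025, Lemma 9.22 (proof)] -/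
theorem Z0_lt_Z0bar (hr : r < rstar) : Z0 r < Z0bar r := by
  unfold Z0 Z0bar; linarith [q_pos hr]

/-- **Lemma 9.22 at `γ = 5/3`, signs**: on the sonic line, `N_Z > 0` to the right of `P_s`
(`Z < Z₀`), `N_Z < 0` strictly between `P̄_s` and `P_s`, and `N_Z > 0` to the left of `P̄_s`
(`Z > Z̄₀`). [cite: BuckmasterCaolaboraGomezserrano2025, Lemma 9.22] -/
theorem NZ_sonicLine_sign (hr : r < rstar) (Z : ℝ) :
    (Z < Z0 r → 0 < NZ r (-3 - 2 * Z) Z) ∧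
    (Z0 r < Z → Z < Z0bar r → NZ r (-3 - 2 * Z) Z < 0) ∧
    (Z0bar r < Z → 0 < NZ r (-3 - 2 * Z) Z) := by
  have hlt := Z0_lt_Z0bar hr
  rw [NZ_on_sonicLine (disc_pos hr).le]
  refine ⟨fun h => ?_, fun h h' => ?_, fun h => ?_⟩
  · have h2 : Z - Z0bar r < 0 := by linarith
    nlinarith [mul_pos (sub_pos.mpr h) (neg_pos.mpr h2)]
  · nlinarith [mul_pos (sub_pos.mpr h) (sub_pos.mpr h')]
  · nlinarith [mul_pos (sub_pos.mpr (hlt.trans h)) (sub_pos.mpr h)]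

/-- The repelling statement used in Proposition 2.5: on the part of the sonic line to the right
of `P_s` and inside `W > Z` (`Z < Z₀`, `Z < −1`), the flux `∇D_Z·(N_W D_Z, N_Z D_W)` is positive.
[cite: BuckmasterCaolaboraGomezserrano2025, Lemma 9.22, Prop. 2.5] -/
theorem sonicLine_flux_pos_right (hr : r < rstar) {Z : ℝ} (hZ : Z < Z0 r) (hZ1 : Z < -1) :
    0 < 1 / 3 * (NW r (-3 - 2 * Z) Z * DZ (-3 - 2 * Z) Z)
      + 2 / 3 * (NZ r (-3 - 2 * Z) Z * DW (-3 - 2 * Z) Z) := by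
  rw [sonicLine_flux, DW_sonicLine]
  have hN := (NZ_sonicLine_sign hr Z).1 hZ
  have hD : 0 < -1 - Z := by linarith
  positivity

/-! ### The closed-form items of Lemma 9.26 (`aux_34bounds`) at `γ = 5/3` -/

/-- `W₁ = −3q < 0` for `r < r*`. [cite: BuckmasterCaolaboraGomezserrano2025, Lemma 9.26] -/
theorem W1_neg (hr : r < rstar) : W1 r < 0 := by
  unfold W1; linarith [q_pos hr]

/-- `∂_Z N_Z(P_s) = 4 − 2r + q > 0` for `r < 2`. [cite: BuckmasterCaolaboraGomezserrano2025, Lemma 9.26] -/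
theorem NZ_Z_Ps_pos (h : r < 2) : 0 < NZ_Z r (W0 r) (Z0 r) := by
  rw [NZ_Z_Ps]; linarith [q_nonneg r]

/-- `Z₁ > 0` for `1 ≤ r < r*` (`Z₁ = (3/2)(2 − r + q − p)` and `p < 2 − r`).
[cite: BuckmasterCaolaboraGomezserrano2025, Lemma 9.26] -/
theorem Z1_pos (hr : r < rstar) : 0 < Z1 r := by
  have hD := DZ1_pos hr
  unfold Z1; linarith [q_nonneg r]

/-- `N_{Z,1} = ∇N_Z(P_s)·(W₁, Z₁) = D_{Z,1} Z₁ > 0` for `1 ≤ r < r*` (the slope quadratic (2.3)).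
[cite: BuckmasterCaolaboraGomezserrano2025, Lemma 9.26] -/
theorem NZ1_pos (h1 : 1 ≤ r) (hr : r < rstar) :
    0 < NZ_W (W0 r) (Z0 r) * W1 r + NZ_Z r (W0 r) (Z0 r) * Z1 r := by
  rw [← slope_eq_Z1 h1 (disc_pos hr).le, DZ1_eq]
  exact mul_pos (DZ1_pos hr) (Z1_pos hr)

/-- `D_Z(P_eye) = 1 − (3 + √3) r / 6`, positive exactly for `r < r* = 3 − √3`.
[cite: BuckmasterCaolaboraGomezserrano2025, Lemma 9.26] -/
theorem DZ_eye (r : ℝ) : DZ (Xeye r) (Yeye r) = 1 - (3 + √3) * r / 6 := by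
  unfold DZ Xeye Yeye; ring

/-- `D_Z(P_eye) > 0` for `r < r*`. [cite: BuckmasterCaolaboraGomezserrano2025, Lemma 9.26] -/
theorem DZ_eye_pos (hr : r < rstar) : 0 < DZ (Xeye r) (Yeye r) := by
  rw [DZ_eye]
  unfold rstar at hr
  have h3 : (√3 : ℝ) ^ 2 = 3 := Real.sq_sqrt (by norm_num)
  have hs : 0 < (√3 : ℝ) := Real.sqrt_pos.mpr (by norm_num)
  -- `(3 + √3) r < (3 + √3)(3 − √3) = 6`
  nlinarith [mul_lt_mul_of_pos_left hr (show (0:ℝ) < 3 + √3 by linarith)]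

/-- `(X₀ + Y₀)/2 = −r/2 > −r` for `r > 0` (`P_eye` lies above the point `(−r, −r)` along `W = Z`'s
normal). [cite: BuckmasterCaolaboraGomezserrano2025, Lemma 9.26] -/
theorem eye_mid_gt (h : 0 < r) : -r < (Xeye r + Yeye r) / 2 := by
  unfold Xeye Yeye; nlinarith

end Monatomic

end BuckmasterCaolaboraGomezserrano2025

end Literature.Analysis.FluidPDE
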